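import Summits.Ventures.PercRepro.Night2OneFatCaseOneMainB
import Summits.Ventures.PercRepro.Night2OneFatCaseOneColumn

/-!
# PercRepro — the sources of a one-coloop target: eight points, or seven points with a unique collinear triple (night-2, gen 29)

The hypothesis `hsrc` of `sum_gtLoadAt_le_cap2_of_sources_triple` (every source `y ≠ y₁` of `S` is a coloop of `(S ∖ y₁) ∖ K`)
holds (a) when `|S ∖ K| ≥ 8` (`mem_coloops_of_source'`: the line of a source's erasure has at least four points), and (b) when
`|S ∖ K| = 7` and `S ∖ K` contains at most one collinear triple: a second source `y` on the line `R₁` of the first source's erasure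
would produce, through its own erasure, a second collinear triple `R ∌ y`.  The corresponding column bounds of `dshGT` follow;
`dload_gt_le_cap2_of_card_coloops_le_one'` collects every target with at most one coloop, the seven-point one-coloop targets being
required to have at most one collinear triple off `K` (the shapes (i)/(ii) of proofs/NIGHT-2-g29.md §4 remain open).
-/

namespace PercRepro.Shadow

open Finset PerFlat ThmH

variable {α : Type*} [DecidableEq α] {M : Matroid α} [M.Finite] {G : Finset α}

section Seven

open scoped Classical in
/-- **Eight points: the sources of a one-coloop target lie among the coloops of any source's erasure.** -/
theorem sources_triple_of_eight (hG : G ∈ flatsQ M (5 + 1)) (hd : (gr M \ G).card = 2) (hk : kColoops M G = 1)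
    (hs : ∀ e ∈ gr M, ∀ f ∈ gr M, e ≠ f → rkN M {e, f} = 2) (hl : ∀ e ∈ gr M, M.Indep {e})
    {S : Finset α} (hSG : S ⊆ G) {w : α} (hc : coloops M (S \ coloops M G) = {w}) (h8 : 8 ≤ (S \ coloops M G).card) :
    ∀ y₁ ∈ S, (∃ w' ∈ S.erase y₁, faceLossP M 5 G (bigP M G) (S.erase y₁) w' ≠ 0) →
      ∀ y ∈ S, y ≠ y₁ → (∃ w' ∈ S.erase y, faceLossP M 5 G (bigP M G) (S.erase y) w' ≠ 0) →
      y ∈ coloops M (S.erase y₁ \ coloops M G) := by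
  intro y₁ hy₁S hsy₁ y hy hyy hsy
  obtain ⟨w₁, hw₁, h0₁⟩ := hsy₁
  obtain ⟨w', hw', hw0⟩ := hsy
  have hd' : (gr M \ G).card ≤ 5 := by omega
  have hGg : G ⊆ gr M := (mem_flatsQ.1 hG).1
  have hc1 : (coloops M (S \ coloops M G)).card ≤ 1 := by rw [hc, Finset.card_singleton]
  obtain ⟨-, hQ₁5, hC₁3, -, hR₁, -⟩ := lossy_structure_of_faceLossP_ne_zero hG hd hk hs hl hw₁ h0₁
  obtain ⟨-, -, hC, -, -, -⟩ := lossy_structure_of_faceLossP_ne_zero hG hd hk hs hl hw' hw0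
  have hy₁K : y₁ ∉ coloops M G := by
    intro hK
    obtain ⟨hthin, -, -, -⟩ := faceLossP_structure h0₁
    exact (Finset.notMem_erase y₁ S) ((Finset.erase_subset _ _) (coloops_subset_of_mem_thinMembers hG hd' hthin hK))
  have hy₁V : y₁ ∈ S \ coloops M G := Finset.mem_sdiff.2 ⟨hy₁S, hy₁K⟩
  have hQ₁V : S.erase y₁ \ coloops M G = (S \ coloops M G).erase y₁ := by
    ext a; simp only [Finset.mem_sdiff, Finset.mem_erase]; tauto
  have hV5 : rkN M (S \ coloops M G) = 5 := by
    have ha : rkN M (S.erase y₁ \ coloops M G) ≤ rkN M (S \ coloops M G) :=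
      rkN_mono (Finset.sdiff_subset_sdiff (Finset.erase_subset _ _) (Finset.Subset.refl _))
    have hb : rkN M (S \ coloops M G) ≤ rkN M (G \ coloops M G) :=
      rkN_mono (Finset.sdiff_subset_sdiff hSG (Finset.Subset.refl _))
    rw [rkN_sdiff_coloops_eq_five hG hk] at hb
    omega
  have hR₁4 : 4 ≤ ((S.erase y₁ \ coloops M G) \ coloops M (S.erase y₁ \ coloops M G)).card := by
    have hcard : (S.erase y₁ \ coloops M G).card + 1 = (S \ coloops M G).card := by
      rw [hQ₁V, Finset.card_erase_of_mem hy₁V]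
      have : 0 < (S \ coloops M G).card := Finset.card_pos.2 ⟨y₁, hy₁V⟩
      omega
    have hCsub : coloops M (S.erase y₁ \ coloops M G) ⊆ S.erase y₁ \ coloops M G :=
      fun a ha => (mem_coloops.1 ha).1
    have := Finset.card_sdiff_add_card_eq_card hCsub
    omega
  exact mem_coloops_of_source' hG hs hSG hV5 hc1 hy₁S hy hyy hQ₁5 hC₁3 hR₁ hR₁4 hC

open scoped Classical in
/-- **Seven points with a unique collinear triple: the sources lie among the coloops of any source's erasure.** A source `y`
off the coloops of `(S ∖ y₁) ∖ K` lies on its line `R₁`; the line `R` of `(S ∖ y) ∖ K` is a second collinear triple of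
`S ∖ K` (it misses `y`). -/
theorem sources_triple_of_unique_line (hG : G ∈ flatsQ M (5 + 1)) (hd : (gr M \ G).card = 2) (hk : kColoops M G = 1)
    (hs : ∀ e ∈ gr M, ∀ f ∈ gr M, e ≠ f → rkN M {e, f} = 2) (hl : ∀ e ∈ gr M, M.Indep {e})
    {S : Finset α} (h7 : (S \ coloops M G).card = 7)
    (huniq : ∀ R₁ R₂ : Finset α, R₁ ⊆ S \ coloops M G → R₂ ⊆ S \ coloops M G → R₁.card = 3 → R₂.card = 3 →
      rkN M R₁ = 2 → rkN M R₂ = 2 → R₁ = R₂) :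
    ∀ y₁ ∈ S, (∃ w' ∈ S.erase y₁, faceLossP M 5 G (bigP M G) (S.erase y₁) w' ≠ 0) →
      ∀ y ∈ S, y ≠ y₁ → (∃ w' ∈ S.erase y, faceLossP M 5 G (bigP M G) (S.erase y) w' ≠ 0) →
      y ∈ coloops M (S.erase y₁ \ coloops M G) := by
  intro y₁ hy₁S hsy₁ y hy hyy hsy
  obtain ⟨w₁, hw₁, h0₁⟩ := hsy₁
  obtain ⟨w', hw', hw0⟩ := hsy
  have hd' : (gr M \ G).card ≤ 5 := by omega
  obtain ⟨-, -, hC₁3, -, hR₁, -⟩ := lossy_structure_of_faceLossP_ne_zero hG hd hk hs hl hw₁ h0₁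
  obtain ⟨-, -, hC3, -, hR, -⟩ := lossy_structure_of_faceLossP_ne_zero hG hd hk hs hl hw' hw0
  have hy₁K : y₁ ∉ coloops M G := by
    intro hK
    obtain ⟨hthin, -, -, -⟩ := faceLossP_structure h0₁
    exact (Finset.notMem_erase y₁ S) ((Finset.erase_subset _ _) (coloops_subset_of_mem_thinMembers hG hd' hthin hK))
  have hyK : y ∉ coloops M G := by
    intro hK
    obtain ⟨hthin, -, -, -⟩ := faceLossP_structure hw0
    exact (Finset.notMem_erase y S) ((Finset.erase_subset _ _) (coloops_subset_of_mem_thinMembers hG hd' hthin hK))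
  have hy₁V : y₁ ∈ S \ coloops M G := Finset.mem_sdiff.2 ⟨hy₁S, hy₁K⟩
  have hyV : y ∈ S \ coloops M G := Finset.mem_sdiff.2 ⟨hy, hyK⟩
  have hQ₁V : S.erase y₁ \ coloops M G = (S \ coloops M G).erase y₁ := by
    ext a; simp only [Finset.mem_sdiff, Finset.mem_erase]; tauto
  have hQV : S.erase y \ coloops M G = (S \ coloops M G).erase y := by
    ext a; simp only [Finset.mem_sdiff, Finset.mem_erase]; tauto
  by_contra hyC
  -- the two lines
  have hCsub₁ : coloops M (S.erase y₁ \ coloops M G) ⊆ S.erase y₁ \ coloops M G := fun a ha => (mem_coloops.1 ha).1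
  have hCsub : coloops M (S.erase y \ coloops M G) ⊆ S.erase y \ coloops M G := fun a ha => (mem_coloops.1 ha).1
  have hQ₁6 : (S.erase y₁ \ coloops M G).card = 6 := by rw [hQ₁V, Finset.card_erase_of_mem hy₁V, h7]
  have hQ6 : (S.erase y \ coloops M G).card = 6 := by rw [hQV, Finset.card_erase_of_mem hyV, h7]
  have hR₁3 : ((S.erase y₁ \ coloops M G) \ coloops M (S.erase y₁ \ coloops M G)).card = 3 := by
    have := Finset.card_sdiff_add_card_eq_card hCsub₁; omega
  have hR3 : ((S.erase y \ coloops M G) \ coloops M (S.erase y \ coloops M G)).card = 3 := by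
    have := Finset.card_sdiff_add_card_eq_card hCsub; omega
  have hR₁sub : (S.erase y₁ \ coloops M G) \ coloops M (S.erase y₁ \ coloops M G) ⊆ S \ coloops M G :=
    Finset.sdiff_subset.trans (by rw [hQ₁V]; exact Finset.erase_subset _ _)
  have hRsub : (S.erase y \ coloops M G) \ coloops M (S.erase y \ coloops M G) ⊆ S \ coloops M G :=
    Finset.sdiff_subset.trans (by rw [hQV]; exact Finset.erase_subset _ _)
  have heq := huniq _ _ hR₁sub hRsub hR₁3 hR3 hR₁ hR
  -- `y` lies on the first line but not on the second
  have hyR₁ : y ∈ (S.erase y₁ \ coloops M G) \ coloops M (S.erase y₁ \ coloops M G) :=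
    Finset.mem_sdiff.2 ⟨Finset.mem_sdiff.2 ⟨Finset.mem_erase.2 ⟨hyy, hy⟩, hyK⟩, hyC⟩
  have hyR : y ∉ (S.erase y \ coloops M G) \ coloops M (S.erase y \ coloops M G) := fun h =>
    (Finset.mem_erase.1 (Finset.mem_sdiff.1 (Finset.mem_sdiff.1 h).1).1).1 rfl
  exact hyR (heq ▸ hyR₁)

open scoped Classical in
/-- The eight-point column bound as a corollary of the general form. -/
theorem sum_gtLoadAt_le_cap2_of_one_coloop' (hG : G ∈ flatsQ M (5 + 1)) (hd : (gr M \ G).card = 2)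
    (hk : kColoops M G = 1) (hs : ∀ e ∈ gr M, ∀ f ∈ gr M, e ≠ f → rkN M {e, f} = 2)
    (hl : ∀ e ∈ gr M, M.Indep {e}) (hfat : (fatClosures M 5 G 2).card ≤ 1) {S : Finset α} (hSG : S ⊆ G)
    (hKS : coloops M G ⊆ S) {w : α} (hc : coloops M (S \ coloops M G) = {w}) (h8 : 8 ≤ (S \ coloops M G).card) :
    ∑ y ∈ S, gtLoadAt M 5 G (bigP M G) (S.erase y) y ≤ cap2 M 5 G S :=
  sum_gtLoadAt_le_cap2_of_sources_triple hG hd hk hs hl hfat hSG hKS hc (sources_triple_of_eight hG hd hk hs hl hSG hc h8)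

open scoped Classical in
/-- **The column bound of `dshGT` at a one-coloop target with seven points off `K` and a unique collinear triple.** -/
theorem dload_gt_le_cap2_of_seven_unique_line (hG : G ∈ flatsQ M (5 + 1)) (hd : (gr M \ G).card = 2)
    (hk : kColoops M G = 1) (hs : ∀ e ∈ gr M, ∀ f ∈ gr M, e ≠ f → rkN M {e, f} = 2)
    (hl : ∀ e ∈ gr M, M.Indep {e}) (hfat : (fatClosures M 5 G 2).card ≤ 1) {S : Finset α} (hSG : S ⊆ G)
    (hKS : coloops M G ⊆ S) {w : α} (hc : coloops M (S \ coloops M G) = {w}) (h7 : (S \ coloops M G).card = 7)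
    (huniq : ∀ R₁ R₂ : Finset α, R₁ ⊆ S \ coloops M G → R₂ ⊆ S \ coloops M G → R₁.card = 3 → R₂.card = 3 →
      rkN M R₁ = 2 → rkN M R₂ = 2 → R₁ = R₂) :
    dload M 5 G (bigP M G) (dshGT M 5 G) S ≤ cap2 M 5 G S :=
  (dload_gt_le_sum (P := bigP M G) hG (by omega) S).trans
    (sum_gtLoadAt_le_cap2_of_sources_triple hG hd hk hs hl hfat hSG hKS hc
      (sources_triple_of_unique_line hG hd hk hs hl h7 huniq))

open scoped Classical in
/-- **The column bound of `dshGT` at every target with at most one coloop**, the one-coloop targets with exactly seven points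
off `K` being required to carry at most one collinear triple (the open shapes (i)/(ii)). -/
theorem dload_gt_le_cap2_of_card_coloops_le_one' (hG : G ∈ flatsQ M (5 + 1)) (hd : (gr M \ G).card = 2)
    (hk : kColoops M G = 1) (hs : ∀ e ∈ gr M, ∀ f ∈ gr M, e ≠ f → rkN M {e, f} = 2)
    (hl : ∀ e ∈ gr M, M.Indep {e}) (hfat : (fatClosures M 5 G 2).card ≤ 1) {S : Finset α} (hSG : S ⊆ G)
    (hKS : coloops M G ⊆ S) (hc1 : (coloops M (S \ coloops M G)).card ≤ 1)
    (h7 : (coloops M (S \ coloops M G)).card = 1 → (S \ coloops M G).card = 7 →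
      ∀ R₁ R₂ : Finset α, R₁ ⊆ S \ coloops M G → R₂ ⊆ S \ coloops M G → R₁.card = 3 → R₂.card = 3 →
        rkN M R₁ = 2 → rkN M R₂ = 2 → R₁ = R₂) :
    dload M 5 G (bigP M G) (dshGT M 5 G) S ≤ cap2 M 5 G S := by
  rcases Nat.le_one_iff_eq_zero_or_eq_one.1 hc1 with h0 | h1
  · exact dload_gt_le_cap2_of_no_coloops hG hd hk hs hl hfat hSG (Finset.card_eq_zero.1 h0)
  · obtain ⟨w, hw⟩ := Finset.card_eq_one.1 h1
    by_cases h6 : (S \ coloops M G).card ≤ 6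
    · exact dload_gt_le_cap2_of_card_le_six hG hd hk hs hl hSG hc1 h6
    by_cases h7' : (S \ coloops M G).card = 7
    · exact dload_gt_le_cap2_of_seven_unique_line hG hd hk hs hl hfat hSG hKS hw h7' (h7 h1 h7')
    · exact dload_gt_le_cap2_of_one_coloop hG hd hk hs hl hfat hSG hKS hw (by omega)

end Seven

end PercRepro.Shadow
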